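import Literature.Geometry.Riemannian.CompositeChartTestFunctions
import Literature.Geometry.Riemannian.NeumannWeakExistence
import Literature.Analysis.PDE.NeumannHalfBallRegularity
import Literature.Analysis.FunctionSpaces.SobolevTraceOperator
import Literature.Analysis.FunctionSpaces.MeyersSerrinProofs
import HarnessLib

/-!
# The weak Neumann solution read in a composite chart

Topic `Geometry/Riemannian`. Theorem file (no definitions, no named facts; everything proved).
Let `g` be a smooth Riemannian metric on `M` (modelled on `ℝᵐ`), `D ⊆ M` measurable, and let
`uₙ` be smooth functions with `uₙ → v` in `L²(D, μ_g)`, `∫_D |∇(uₙ − uₙ')|²_g → 0` and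
`∫_D f g⁻¹(duₙ, dw) dμ_g → −∫_D F w dμ_g` for all smooth `w` — the approximants of the weak Neumann
problem `div(f∇u) = F` produced by `exists_smooth_weakNeumann_approx`. Let `Φ = Ψ ∘ φ` be a
composite chart at `x` (`φ = extChartAt (𝓡 m) x`, `Ψ` a `C^∞` local diffeomorphism of `ℝᵐ` with
`Ψ.source ⊆ φ.target`), `B̄(z, r) ⊆ Ψ.target`, and `Q ⊆ B(z, r)` open with
`D ∩ Φ⁻¹(B(z, r)) = Φ⁻¹(Q)` (e.g. `Q` a coordinate ball inside `D`, or the half-ball of a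
boundary-flattening chart). Then (`exists_weakNeumann_chartTransfer`) the composite
representatives `uₙ ∘ Φ⁻¹` converge in `L²(Q)` to a function `ut`, their gradients converge in
`L²(Q)` to a weak gradient `gu` of `ut`, `ut ∘ Φ = v` a.e. on `Φ⁻¹(Q)`, and for every Euclidean
test function `ζ ∈ C_c^∞(B(z, r))` (NOT necessarily vanishing on `∂Q ∩ B(z, r)`):

  `∫_Q Dζ(w) ((ρ f̃)(w) • M(w) gu(w)) dw = −∫_Q ρ(w) F̃(w) ζ(w) dw`,

`ρ = |det DΨ⁻¹| √det(h_ij) ∘ Ψ⁻¹` the composite density, `f̃ = f ∘ Φ⁻¹`, `F̃ = F ∘ Φ⁻¹`, `M` the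
coefficient field of `CompositeChartEnergy.lean` — the Euclidean weak formulation of a
Neumann-type problem on `Q` with coefficients `A = ρ f̃ M` (M. E. Taylor, *PDE I* (2011), §5.7;
the change of variables of E. Hebey (1999), §2.2). The limits are taken with the `L²` pairing
lemma `tendsto_integral_bilin_of_tendsto_eLpNorm`.

## References

* M. E. Taylor, *Partial Differential Equations I*, 2nd ed. (2011), Ch. 5 §7. [TaylorPDEI2011]
* E. Hebey, *Nonlinear Analysis on Manifolds: Sobolev Spaces and Inequalities* (1999), §2.2.
-/

noncomputable section

open MeasureTheory Measure Set Filter Metric Module InnerProductSpace TopologicalSpace Function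
open scoped ENNReal NNReal Manifold ContDiff Topology RealInnerProductSpace

namespace Literature.Geometry.Riemannian

open Lorentzian
open Bundle PseudoRiemannianMetric Literature.Analysis.Calculus Literature.Geometry.Manifold
  Literature.Analysis.FunctionSpaces Literature.Analysis.PDE

variable {m : ℕ} {M : Type*} [TopologicalSpace M] [ChartedSpace (EuclideanSpace ℝ (Fin m)) M]
  [IsManifold (𝓡 m) ∞ M] [T2Space M] [LocallyCompactSpace M] [MeasurableSpace M] [BorelSpace M]

/-! ### Auxiliary lemmas -/

/-- A function continuous on a measurable set `T` composed into `T.indicator` is measurable when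
the inner function is measurable: `T.indicator (v ∘ G)` for `G` continuous on `T` and `v`
measurable. [folklore] -/
private theorem measurable_indicator_comp_of_continuousOn_aux {X : Type*} [TopologicalSpace X]
    [MeasurableSpace X] [OpensMeasurableSpace X] {T : Set X} (hT : MeasurableSet T)
    {P : Type*} [TopologicalSpace P] [MeasurableSpace P] [BorelSpace P] {G : X → P}
    (hG : ContinuousOn G T) {v : P → ℝ} (hv : Measurable v) :
    Measurable (T.indicator fun y ↦ v (G y)) := by
  refine measurable_of_restrict_of_restrict_compl hT ?_ ?_
  · have h1 : T.restrict (T.indicator fun y ↦ v (G y)) = v ∘ T.restrict G := by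
      funext y
      simp only [Set.restrict_apply, Function.comp_apply, Set.indicator_of_mem y.2]
    rw [h1]
    exact hv.comp (continuousOn_iff_continuous_restrict.1 hG).measurable
  · have h2 : Tᶜ.restrict (T.indicator fun y ↦ v (G y)) = fun _ ↦ 0 := by
      funext y
      have hy : (y : X) ∉ T := y.2
      simp only [Set.restrict_apply, Set.indicator_of_notMem hy]
    rw [h2]
    exact measurable_const

/-- `‖·‖_{L²}` of a sequence tends to `0` when the squared `lintegral`s do. [folklore] -/
theorem tendsto_eLpNorm_two_of_tendsto_lintegral_sq {X : Type*} [MeasurableSpace X]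
    {ν : Measure X} {F' : Type*} [NormedAddCommGroup F'] {w : ℕ → X → F'}
    (hw : Tendsto (fun n ↦ ∫⁻ y, ‖w n y‖ₑ ^ 2 ∂ν) atTop (𝓝 0)) :
    Tendsto (fun n ↦ eLpNorm (w n) 2 ν) atTop (𝓝 0) := by
  have h1 : ∀ n, eLpNorm (w n) 2 ν = (∫⁻ y, ‖w n y‖ₑ ^ 2 ∂ν) ^ (1 / 2 : ℝ) := fun n ↦ by
    rw [eLpNorm_eq_lintegral_rpow_enorm_toReal (by norm_num) (by norm_num), ENNReal.toReal_ofNat]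
    congr 1
    refine lintegral_congr fun y ↦ ?_
    rw [← ENNReal.rpow_natCast]; norm_num
  simp_rw [h1]
  have h2 : Tendsto (fun t : ℝ≥0∞ ↦ t ^ (1 / 2 : ℝ)) (𝓝 0) (𝓝 0) := by
    have := (ENNReal.continuous_rpow_const (y := (1 / 2 : ℝ))).tendsto 0
    rwa [ENNReal.zero_rpow_of_pos (by norm_num)] at this
  exact h2.comp hw

/-- `‖f‖_{L²(μ)}² = ∫ ‖f‖ₑ²`. [folklore] -/
private theorem eLpNorm_two_sq_eq {X : Type*} [MeasurableSpace X] {ν : Measure X}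
    {ε : Type*} [ENorm ε] (f : X → ε) : eLpNorm f 2 ν ^ 2 = ∫⁻ y, ‖f y‖ₑ ^ 2 ∂ν := by
  rw [eLpNorm_eq_lintegral_rpow_enorm_toReal (by norm_num) (by norm_num), ENNReal.toReal_ofNat,
    ← ENNReal.rpow_natCast, ← ENNReal.rpow_mul]
  norm_num

variable (g : PseudoRiemannianMetric (𝓡 m) ∞ (EuclideanSpace ℝ (Fin m))
  (TangentSpace (𝓡 m) : M → Type _))

set_option maxHeartbeats 1600000 in
/-- **The weak Neumann solution in a composite chart.** See the module docstring.
[cite: TaylorPDEI2011, Ch. 5 §7, (7.11)–(7.14)] -/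
theorem exists_weakNeumann_chartTransfer [g.HasLeviCivita] (hg : g.IsRiemannian) (x : M)
    {Ψ : OpenPartialHomeomorph (EuclideanSpace ℝ (Fin m)) (EuclideanSpace ℝ (Fin m))}
    (hΨt : Ψ.source ⊆ (extChartAt (𝓡 m) x).target) (hΨ : ContDiffOn ℝ ∞ Ψ Ψ.source)
    (hΨ' : ContDiffOn ℝ ∞ Ψ.symm Ψ.target)
    {z : EuclideanSpace ℝ (Fin m)} {r : ℝ} (hball : closedBall z r ⊆ Ψ.target)
    {Q : Set (EuclideanSpace ℝ (Fin m))} (hQo : IsOpen Q) (hQB : Q ⊆ ball z r)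
    {D : Set M} (hDm : MeasurableSet D) {KD : Set M} (hKD : IsCompact KD) (hDKD : D ⊆ KD)
    (hDQ : D ∩ ((extChartAt (𝓡 m) x).source ∩ extChartAt (𝓡 m) x ⁻¹' (Ψ.symm '' ball z r)) =
      (extChartAt (𝓡 m) x).source ∩ extChartAt (𝓡 m) x ⁻¹' (Ψ.symm '' Q))
    {u : ℕ → M → ℝ} {v : M → ℝ} (hus : ∀ n, ContMDiff (𝓡 m) 𝓘(ℝ, ℝ) ∞ (u n))
    (hvm : MemLp v 2 ((riemannianMeasure (g.toContMDiffRiemannianMetric hg)).restrict D))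
    (hL2 : Tendsto (fun n ↦ eLpNorm (u n - v) 2
      ((riemannianMeasure (g.toContMDiffRiemannianMetric hg)).restrict D)) atTop (𝓝 0))
    (hE : ∀ ε > 0, ∃ N, ∀ n ≥ N, ∀ n' ≥ N,
      ∫ p in D, g.gradSq (u n - u n') p ∂riemannianMeasure (g.toContMDiffRiemannianMetric hg) < ε)
    {f : M → ℝ} (hf : Continuous f) {F : M → ℝ} (hF : Continuous F)
    (hweak : ∀ w : M → ℝ, ContMDiff (𝓡 m) 𝓘(ℝ, ℝ) ∞ w →
      Tendsto (fun n ↦ ∫ p in D, f p * g.innerDual p (mvfderiv (𝓡 m) (u n) p).toLinearMap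
        (mvfderiv (𝓡 m) w p).toLinearMap ∂riemannianMeasure (g.toContMDiffRiemannianMetric hg))
        atTop (𝓝 (-∫ p in D, F p * w p ∂riemannianMeasure (g.toContMDiffRiemannianMetric hg)))) :
    ∃ (ut : EuclideanSpace ℝ (Fin m) → ℝ) (gu : EuclideanSpace ℝ (Fin m) → EuclideanSpace ℝ (Fin m)),
      MemLp ut 2 (volume.restrict Q) ∧ MemLp gu 2 (volume.restrict Q) ∧
      HasWeakFDerivOn ⟨Q, hQo⟩ volume ut (fun y ↦ innerSL ℝ (gu y)) ∧
      (∀ᵐ p ∂riemannianMeasure (g.toContMDiffRiemannianMetric hg),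
        p ∈ (extChartAt (𝓡 m) x).source ∩ extChartAt (𝓡 m) x ⁻¹' (Ψ.symm '' Q) →
          ut (Ψ (extChartAt (𝓡 m) x p)) = v p) ∧
      (Tendsto (fun n ↦ eLpNorm (fun w ↦ (u n ((extChartAt (𝓡 m) x).symm (Ψ.symm w))) - ut w) 2
        (volume.restrict Q)) atTop (𝓝 0)) ∧
      (Tendsto (fun n ↦ eLpNorm (fun w ↦ gradient (u n ∘ (extChartAt (𝓡 m) x).symm ∘ Ψ.symm) w
        - gu w) 2 (volume.restrict Q)) atTop (𝓝 0)) ∧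
      ∀ ζ : EuclideanSpace ℝ (Fin m) → ℝ, ContDiff ℝ ∞ ζ → HasCompactSupport ζ →
        tsupport ζ ⊆ ball z r →
        ∫ w in Q, fderiv ℝ ζ w
          (((|(fderiv ℝ Ψ.symm w).det| *
              Real.sqrt (chartGramMatrix (g.toContMDiffRiemannianMetric hg) x (Ψ.symm w)).det) *
              f ((extChartAt (𝓡 m) x).symm (Ψ.symm w))) •
            (∑ i, ∑ j, (chartGramMatrix (g.toContMDiffRiemannianMetric hg) x (Ψ.symm w))⁻¹ i j •
              (innerSL ℝ (fderiv ℝ Ψ (Ψ.symm w) (EuclideanSpace.single i 1))).smulRight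
                (fderiv ℝ Ψ (Ψ.symm w) (EuclideanSpace.single j 1))) (gu w)) =
        ∫ w in Q, -((|(fderiv ℝ Ψ.symm w).det| *
            Real.sqrt (chartGramMatrix (g.toContMDiffRiemannianMetric hg) x (Ψ.symm w)).det) *
            F ((extChartAt (𝓡 m) x).symm (Ψ.symm w))) * ζ w := by
  classical
  set h := g.toContMDiffRiemannianMetric hg with hh_def
  haveI : (ofRiemannian h).HasLeviCivita := ‹g.HasLeviCivita›
  set μ : Measure M := riemannianMeasure h with hμ
  set φ := extChartAt (𝓡 m) x with hφ
  set ν : Measure (EuclideanSpace ℝ (Fin m)) := volume.restrict Q with hν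
  haveI : IsFiniteMeasureOnCompacts μ :=
    ⟨fun K hK ↦ riemannianVolume_lt_top_of_isCompact_holds h le_rfl hK⟩
  -- notation for the density, the coefficient field, the representatives
  obtain ⟨ρ, hρ⟩ : ∃ ρ : EuclideanSpace ℝ (Fin m) → ℝ, ∀ w, ρ w =
      |(fderiv ℝ Ψ.symm w).det| * Real.sqrt (chartGramMatrix h x (Ψ.symm w)).det :=
    ⟨_, fun _ ↦ rfl⟩
  obtain ⟨Mf, hMf⟩ : ∃ Mf : EuclideanSpace ℝ (Fin m) → EuclideanSpace ℝ (Fin m) →L[ℝ]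
      EuclideanSpace ℝ (Fin m), ∀ w, Mf w = ∑ i, ∑ j, (chartGramMatrix h x (Ψ.symm w))⁻¹ i j •
        (innerSL ℝ (fderiv ℝ Ψ (Ψ.symm w) (EuclideanSpace.single i 1))).smulRight
          (fderiv ℝ Ψ (Ψ.symm w) (EuclideanSpace.single j 1)) := ⟨_, fun _ ↦ rfl⟩
  obtain ⟨Φi, hΦi⟩ : ∃ Φi : EuclideanSpace ℝ (Fin m) → M, ∀ w, Φi w = φ.symm (Ψ.symm w) :=
    ⟨_, fun _ ↦ rfl⟩
  obtain ⟨ut_, hut_⟩ : ∃ ut_ : ℕ → EuclideanSpace ℝ (Fin m) → ℝ, ∀ n w, ut_ n w = u n (Φi w) :=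
    ⟨fun n w ↦ u n (Φi w), fun _ _ ↦ rfl⟩
  obtain ⟨G, hG⟩ : ∃ G : ℕ → EuclideanSpace ℝ (Fin m) → EuclideanSpace ℝ (Fin m), ∀ n w,
      G n w = gradient (u n ∘ φ.symm ∘ Ψ.symm) w := ⟨fun n w ↦ gradient (u n ∘ φ.symm ∘ Ψ.symm) w,
    fun _ _ ↦ rfl⟩
  -- basic sets
  set K : Set (EuclideanSpace ℝ (Fin m)) := closedBall z r with hK
  have hKc : IsCompact K := isCompact_closedBall _ _
  have hKt : K ⊆ Ψ.target := hball
  have hQK : Q ⊆ K := hQB.trans ball_subset_closedBall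
  have hQt : Q ⊆ Ψ.target := hQK.trans hKt
  have hQm : MeasurableSet Q := hQo.measurableSet
  have hBt : ball z r ⊆ Ψ.target := ball_subset_closedBall.trans hball
  have hvolQ : volume Q < ⊤ := (measure_mono hQK).trans_lt hKc.measure_lt_top
  haveI : IsFiniteMeasure ν := ⟨by rw [hν, Measure.restrict_apply_univ]; exact hvolQ⟩
  have hΨd : DifferentiableOn ℝ Ψ Ψ.source := hΨ.differentiableOn (by simp)
  have hΨ'd : DifferentiableOn ℝ Ψ.symm Ψ.target := hΨ'.differentiableOn (by simp)
  have hΨ'1 : ContDiffOn ℝ 1 Ψ.symm Ψ.target := hΨ'.of_le (by norm_cast)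
  have hdΨ : ∀ w ∈ Ψ.target, DifferentiableAt ℝ Ψ (Ψ.symm w) := fun w hw ↦
    (hΨd _ (Ψ.map_target hw)).differentiableAt (Ψ.open_source.mem_nhds (Ψ.map_target hw))
  have hdΨ' : ∀ w ∈ Ψ.target, DifferentiableAt ℝ Ψ.symm w := fun w hw ↦
    (hΨ'd _ hw).differentiableAt (Ψ.open_target.mem_nhds hw)
  -- continuity of `Φ⁻¹` on `Ψ.target`
  have hΦic : ContinuousOn Φi Ψ.target := by
    have : ContinuousOn (fun w ↦ φ.symm (Ψ.symm w)) Ψ.target :=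
      (continuousOn_extChartAt_symm x).comp Ψ.continuousOn_symm fun w hw ↦ hΨt (Ψ.map_target hw)
    exact this.congr fun w _ ↦ hΦi w
  have hΦiK : IsCompact (Φi '' K) := hKc.image_of_continuousOn (hΦic.mono hKt)
  -- the piece over `Q`
  set PQ : Set M := φ.source ∩ φ ⁻¹' (Ψ.symm '' Q) with hPQ
  have hPQD : PQ ⊆ D := fun p hp ↦ (hDQ.symm.subset hp).1
  have hPQsub : PQ ⊆ Φi '' K := by
    rintro p ⟨hp, w, hwQ, hw⟩
    refine ⟨w, hQK hwQ, ?_⟩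
    rw [hΦi, hw, φ.left_inv hp]
  /- Step 0: bounds on `K` -/
  obtain ⟨lamρ, Lamρ, hlamρ, -, hdens⟩ := exists_compositeDensity_bounds h x hΨt hΨd hΨ'1 hKc hKt
  obtain ⟨lam', Lam', hlam', -, hgrad⟩ := exists_gradSq_compositeChart_bounds h x hΨt hΨ hΨ' hKc hKt
  obtain ⟨lamM, LamM, hlamM, -, hMb⟩ := exists_compositeCoeff_bounds h x hΨt hΨ hΨ' hKc hKt
  have hρK : ∀ w ∈ K, lamρ ≤ ρ w ∧ ρ w ≤ Lamρ := fun w hw ↦ by rw [hρ]; exact hdens w hw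
  have hρpos : ∀ w ∈ Ψ.target, 0 < ρ w := fun w hw ↦ by
    rw [hρ]; exact compositeDensity_pos h x hΨt hΨd hΨ'd hw
  have hρc : ContinuousOn ρ Ψ.target := by
    have := continuousOn_compositeDensity h x hΨt hΨ'1
    exact this.congr fun w _ ↦ hρ w
  have hMc : ContinuousOn Mf Ψ.target := by
    have := (contDiffOn_compositeCoeff h x hΨt hΨ hΨ').continuousOn
    exact this.congr fun w _ ↦ hMf w
  have hMK : ∀ w ∈ K, ‖Mf w‖ ≤ LamM := fun w hw ↦ by rw [hMf]; exact (hMb w hw 0).2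
  -- bounds for `f`, `F` on `Φ⁻¹(K)`
  obtain ⟨Cf, hCf⟩ := hΦiK.exists_bound_of_continuousOn hf.continuousOn
  obtain ⟨CF, hCF⟩ := hΦiK.exists_bound_of_continuousOn hF.continuousOn
  /- Step 1: the representatives `ũₙ` are smooth on `Ψ.target` -/
  have hrep : ∀ n, ContDiffOn ℝ ∞ (u n ∘ φ.symm ∘ Ψ.symm) Ψ.target := fun n ↦ by
    have h1 : ContDiffOn ℝ ∞ (u n ∘ φ.symm) φ.target := contDiffOn_comp_extChartAt_symm (hus n)
    exact h1.comp hΨ' fun w hw ↦ hΨt (Ψ.map_target hw)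
  have hut_eq : ∀ n, ut_ n = u n ∘ φ.symm ∘ Ψ.symm := fun n ↦ by
    funext w; rw [hut_, hΦi]; rfl
  have hut_c : ∀ n, ContinuousOn (ut_ n) Ψ.target := fun n ↦ by
    rw [hut_eq]; exact (hrep n).continuousOn
  have hGc : ∀ n, ContinuousOn (G n) Ψ.target := fun n ↦ by
    have h1 : ContinuousOn (fun w ↦ fderiv ℝ (u n ∘ φ.symm ∘ Ψ.symm) w) Ψ.target :=
      (hrep n).continuousOn_fderiv_of_isOpen Ψ.open_target (by norm_cast)
    have h2 : ContinuousOn (fun w ↦ (InnerProductSpace.toDual ℝ (EuclideanSpace ℝ (Fin m))).symm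
        (fderiv ℝ (u n ∘ φ.symm ∘ Ψ.symm) w)) Ψ.target :=
      (InnerProductSpace.toDual ℝ _).symm.continuous.comp_continuousOn h1
    refine h2.congr fun w _ ↦ ?_
    rw [hG]; rfl
  -- `L²` membership of continuous-on-`Ψ.target` functions on `Q`
  have hmemQ : ∀ {k : EuclideanSpace ℝ (Fin m) → ℝ}, ContinuousOn k Ψ.target → MemLp k 2 ν := by
    intro k hk
    obtain ⟨C, hC⟩ := hKc.exists_bound_of_continuousOn (hk.mono hKt)
    refine MemLp.of_bound ((hk.mono hQt).aestronglyMeasurable hQm) C ?_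
    rw [hν, ae_restrict_iff' hQm]
    exact Eventually.of_forall fun w hw ↦ hC w (hQK hw)
  have hmemQ' : ∀ {k : EuclideanSpace ℝ (Fin m) → EuclideanSpace ℝ (Fin m)},
      ContinuousOn k Ψ.target → MemLp k 2 ν := by
    intro k hk
    obtain ⟨C, hC⟩ := hKc.exists_bound_of_continuousOn (hk.mono hKt)
    refine MemLp.of_bound ((hk.mono hQt).aestronglyMeasurable hQm) C ?_
    rw [hν, ae_restrict_iff' hQm]
    exact Eventually.of_forall fun w hw ↦ hC w (hQK hw)
  have hut_m : ∀ n, MemLp (ut_ n) 2 ν := fun n ↦ hmemQ (hut_c n)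
  have hGm : ∀ n, MemLp (G n) 2 ν := fun n ↦ hmemQ' (hGc n)
  /- Step 2: a measurable version of `v` and the target representative `ut` -/
  set v' : M → ℝ := hvm.1.mk v with hv'
  have hv'm : Measurable v' := hvm.1.stronglyMeasurable_mk.measurable
  have hvv' : v =ᵐ[μ.restrict D] v' := hvm.1.ae_eq_mk
  set ut : EuclideanSpace ℝ (Fin m) → ℝ := Ψ.target.indicator fun w ↦ v' (Φi w) with hut
  have hutm : Measurable ut :=
    measurable_indicator_comp_of_continuousOn_aux Ψ.open_target.measurableSet hΦic hv'm
  have hutQ : ∀ w ∈ Q, ut w = v' (Φi w) := fun w hw ↦ by rw [hut, indicator_of_mem (hQt hw)]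
  /- Step 3: `ũₙ → ut` in `L²(Q)` -/
  have hL2' : Tendsto (fun n ↦ eLpNorm (u n - v') 2 (μ.restrict D)) atTop (𝓝 0) := by
    refine hL2.congr fun n ↦ eLpNorm_congr_ae ?_
    exact EventuallyEq.rfl.sub hvv'
  have hconvU : Tendsto (fun n ↦ eLpNorm (fun w ↦ ut_ n w - ut w) 2 ν) atTop (𝓝 0) := by
    apply tendsto_eLpNorm_two_of_tendsto_lintegral_sq
    -- `∫_Q |ũₙ - ut|² ≤ λρ⁻¹ ∫_D |uₙ - v'|² dμ`
    have hkey : ∀ n, ∫⁻ w, ‖ut_ n w - ut w‖ₑ ^ 2 ∂ν ≤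
        (ENNReal.ofReal lamρ)⁻¹ * eLpNorm (u n - v') 2 (μ.restrict D) ^ 2 := by
      intro n
      have hmeasU : Measurable fun p ↦ (‖u n p - v' p‖ₑ : ℝ≥0∞) ^ 2 :=
        ((hus n).continuous.measurable.sub hv'm).enorm.pow_const 2
      have h1 := setLIntegral_compositeChart h x hΨt hΨ'd hQm hQt hmeasU
      -- pointwise on `Q`: `λρ |ũₙ - ut|² ≤ ρ |ũₙ - ut|²`
      have h2 : ∫⁻ w in Q, ENNReal.ofReal lamρ * ‖ut_ n w - ut w‖ₑ ^ 2 ≤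
          ∫⁻ w in Q, ENNReal.ofReal |(fderiv ℝ Ψ.symm w).det| *
            ((‖u n (φ.symm (Ψ.symm w)) - v' (φ.symm (Ψ.symm w))‖ₑ : ℝ≥0∞) ^ 2 *
              ENNReal.ofReal (Real.sqrt (chartGramMatrix h x (Ψ.symm w)).det)) := by
        refine setLIntegral_mono' hQm fun w hw ↦ ?_
        have hval : ut_ n w - ut w = u n (φ.symm (Ψ.symm w)) - v' (φ.symm (Ψ.symm w)) := by
          rw [hut_, hutQ w hw, hΦi]
        rw [hval]
        have hρle : ENNReal.ofReal lamρ ≤ ENNReal.ofReal |(fderiv ℝ Ψ.symm w).det| *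
            ENNReal.ofReal (Real.sqrt (chartGramMatrix h x (Ψ.symm w)).det) := by
          rw [← ENNReal.ofReal_mul (abs_nonneg _), ← hρ]
          exact ENNReal.ofReal_le_ofReal (hρK w (hQK hw)).1
        calc ENNReal.ofReal lamρ * (‖u n (φ.symm (Ψ.symm w)) - v' (φ.symm (Ψ.symm w))‖ₑ : ℝ≥0∞) ^ 2
            ≤ (ENNReal.ofReal |(fderiv ℝ Ψ.symm w).det| *
                ENNReal.ofReal (Real.sqrt (chartGramMatrix h x (Ψ.symm w)).det)) *
              (‖u n (φ.symm (Ψ.symm w)) - v' (φ.symm (Ψ.symm w))‖ₑ : ℝ≥0∞) ^ 2 := by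
              gcongr
          _ = _ := by ring
      have h3 : ENNReal.ofReal lamρ * ∫⁻ w in Q, ‖ut_ n w - ut w‖ₑ ^ 2 ≤
          ∫⁻ p in PQ, (‖u n p - v' p‖ₑ : ℝ≥0∞) ^ 2 ∂μ := by
        rw [← lintegral_const_mul' _ _ ENNReal.ofReal_ne_top, hPQ, h1]
        simpa only using h2
      have h4 : ∫⁻ p in PQ, (‖u n p - v' p‖ₑ : ℝ≥0∞) ^ 2 ∂μ ≤
          eLpNorm (u n - v') 2 (μ.restrict D) ^ 2 := by
        have hsq : eLpNorm (u n - v') 2 (μ.restrict D) ^ 2 = ∫⁻ p in D, ‖u n p - v' p‖ₑ ^ 2 ∂μ := by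
          rw [eLpNorm_two_sq_eq]; rfl
        rw [hsq]
        exact lintegral_mono_set hPQD
      calc ∫⁻ w, ‖ut_ n w - ut w‖ₑ ^ 2 ∂ν
          = (ENNReal.ofReal lamρ)⁻¹ * (ENNReal.ofReal lamρ * ∫⁻ w in Q, ‖ut_ n w - ut w‖ₑ ^ 2) := by
            rw [← mul_assoc, ENNReal.inv_mul_cancel (ENNReal.ofReal_pos.2 hlamρ).ne'
              ENNReal.ofReal_ne_top, one_mul]
        _ ≤ (ENNReal.ofReal lamρ)⁻¹ * eLpNorm (u n - v') 2 (μ.restrict D) ^ 2 := by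
            gcongr
            exact h3.trans h4
    have hlim : Tendsto (fun n ↦ (ENNReal.ofReal lamρ)⁻¹ * eLpNorm (u n - v') 2 (μ.restrict D) ^ 2)
        atTop (𝓝 0) := by
      have h1 : Tendsto (fun n ↦ eLpNorm (u n - v') 2 (μ.restrict D) ^ 2) atTop (𝓝 0) := by
        have h0 := ((ENNReal.continuous_pow 2).tendsto (0 : ℝ≥0∞)).comp hL2'
        rw [zero_pow two_ne_zero] at h0
        exact h0
      have h2 := ENNReal.Tendsto.const_mul h1 (Or.inr (ENNReal.inv_ne_top.2
        (ENNReal.ofReal_pos.2 hlamρ).ne'))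
      rwa [mul_zero] at h2
    exact tendsto_of_tendsto_of_tendsto_of_le_of_le tendsto_const_nhds hlim (fun _ ↦ bot_le) hkey
  -- consequently `ut ∈ L²(Q)`
  have hutL : MemLp ut 2 ν := by
    -- `ut = ũₙ - (ũₙ - ut)` with both terms in `L²` for `n` large
    have hev : ∀ᶠ n in atTop, eLpNorm (fun w ↦ ut_ n w - ut w) 2 ν < 1 :=
      (tendsto_order.1 hconvU).2 1 zero_lt_one
    obtain ⟨n, hn⟩ := hev.exists
    have hdm : MemLp (fun w ↦ ut_ n w - ut w) 2 ν :=
      ⟨(hut_m n).1.sub (hutm.aestronglyMeasurable), hn.trans ENNReal.one_lt_top⟩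
    have : ut = fun w ↦ ut_ n w - (ut_ n w - ut w) := by funext w; ring
    rw [this]
    exact (hut_m n).sub hdm
  /- Step 4: the gradients are Cauchy in `L²(Q)` and converge to `gu` -/
  have hGdiff : ∀ n n' w, w ∈ Ψ.target → G n w - G n' w =
      gradient ((u n - u n') ∘ φ.symm ∘ Ψ.symm) w := by
    intro n n' w hw
    have hdn : DifferentiableAt ℝ (u n ∘ φ.symm ∘ Ψ.symm) w :=
      ((hrep n).differentiableOn (by simp) w hw).differentiableAt (Ψ.open_target.mem_nhds hw)
    have hdn' : DifferentiableAt ℝ (u n' ∘ φ.symm ∘ Ψ.symm) w :=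
      ((hrep n').differentiableOn (by simp) w hw).differentiableAt (Ψ.open_target.mem_nhds hw)
    have hfun : (u n - u n') ∘ φ.symm ∘ Ψ.symm =
        (u n ∘ φ.symm ∘ Ψ.symm) - (u n' ∘ φ.symm ∘ Ψ.symm) := by
      funext w; simp
    rw [hG, hG, hfun]
    unfold gradient
    rw [fderiv_sub hdn hdn', map_sub]
  have hGcauchy : ∀ ε : ℝ≥0∞, 0 < ε → ∃ N, ∀ n ≥ N, ∀ n' ≥ N, eLpNorm (G n - G n') 2 ν < ε := by
    intro ε hε
    rcases eq_or_ne ε ⊤ with rfl | hεt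
    · exact ⟨0, fun n _ n' _ ↦ ((hGm n).sub (hGm n')).eLpNorm_lt_top⟩
    have hεr : 0 < ε.toReal := ENNReal.toReal_pos hε.ne' hεt
    -- the squared `L²(Q)` distance is bounded by `(λ' λρ)⁻¹ ∫_D |∇(uₙ - uₙ')|²`
    set c : ℝ := lam' * lamρ with hc
    have hc0 : 0 < c := mul_pos hlam' hlamρ
    obtain ⟨N, hN⟩ := hE (c * ε.toReal ^ 2 / 2) (by positivity)
    refine ⟨N, fun n hn n' hn' ↦ ?_⟩
    have hEn := hN n hn n' hn'
    -- pointwise bound on `Q`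
    have hmeasS : Measurable fun p ↦ ENNReal.ofReal (g.gradSq (u n - u n') p) :=
      ENNReal.measurable_ofReal.comp (continuous_innerDual_mvfderiv g
        (((hus n).sub (hus n')).of_le (by norm_cast)) (((hus n).sub (hus n')).of_le (by norm_cast))).measurable
    have h1 := setLIntegral_compositeChart h x hΨt hΨ'd hQm hQt hmeasS
    have hpt : ∀ w ∈ Q, ENNReal.ofReal c * ‖(G n - G n') w‖ₑ ^ 2 ≤
        ENNReal.ofReal |(fderiv ℝ Ψ.symm w).det| *
          (ENNReal.ofReal (g.gradSq (u n - u n') (φ.symm (Ψ.symm w))) *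
            ENNReal.ofReal (Real.sqrt (chartGramMatrix h x (Ψ.symm w)).det)) := by
      intro w hw
      have hwt := hQt hw
      have hmd : MDifferentiableAt (𝓡 m) 𝓘(ℝ, ℝ) (u n - u n') (φ.symm (Ψ.symm w)) :=
        (((hus n).sub (hus n')) _).mdifferentiableAt (by simp)
      have hlow := (hgrad w (hQK hw) (u n - u n') hmd).1
      have hgs : g.gradSq (u n - u n') (φ.symm (Ψ.symm w)) =
          (ofRiemannian h).innerDual (φ.symm (Ψ.symm w))
            (mvfderiv (𝓡 m) (u n - u n') (φ.symm (Ψ.symm w))).toLinearMap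
            (mvfderiv (𝓡 m) (u n - u n') (φ.symm (Ψ.symm w))).toLinearMap := rfl
      have hgs0 : 0 ≤ g.gradSq (u n - u n') (φ.symm (Ψ.symm w)) := by
        rw [hgs]; exact le_trans (mul_nonneg hlam'.le (sq_nonneg _)) hlow
      have hreal : c * ‖gradient ((u n - u n') ∘ φ.symm ∘ Ψ.symm) w‖ ^ 2 ≤
          g.gradSq (u n - u n') (φ.symm (Ψ.symm w)) * ρ w := by
        rw [hc]
        calc lam' * lamρ * ‖gradient ((u n - u n') ∘ φ.symm ∘ Ψ.symm) w‖ ^ 2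
            = (lam' * ‖gradient ((u n - u n') ∘ φ.symm ∘ Ψ.symm) w‖ ^ 2) * lamρ := by ring
          _ ≤ g.gradSq (u n - u n') (φ.symm (Ψ.symm w)) * ρ w :=
              mul_le_mul (by rw [hgs]; exact hlow) (hρK w (hQK hw)).1 hlamρ.le hgs0
      have hlhs : ENNReal.ofReal c * ‖(G n - G n') w‖ₑ ^ 2 =
          ENNReal.ofReal (c * ‖gradient ((u n - u n') ∘ φ.symm ∘ Ψ.symm) w‖ ^ 2) := by
        rw [Pi.sub_apply, hGdiff n n' w hwt, ← ofReal_norm, ← ENNReal.ofReal_pow (norm_nonneg _),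
          ← ENNReal.ofReal_mul hc0.le]
      have hrhs : ENNReal.ofReal |(fderiv ℝ Ψ.symm w).det| *
          (ENNReal.ofReal (g.gradSq (u n - u n') (φ.symm (Ψ.symm w))) *
            ENNReal.ofReal (Real.sqrt (chartGramMatrix h x (Ψ.symm w)).det)) =
          ENNReal.ofReal (g.gradSq (u n - u n') (φ.symm (Ψ.symm w)) * ρ w) := by
        rw [hρ, ENNReal.ofReal_mul hgs0, ENNReal.ofReal_mul (abs_nonneg _)]; ring
      rw [hlhs, hrhs]
      exact ENNReal.ofReal_le_ofReal hreal
    have h2 : ENNReal.ofReal c * ∫⁻ w, ‖(G n - G n') w‖ₑ ^ 2 ∂ν ≤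
        ∫⁻ p in PQ, ENNReal.ofReal (g.gradSq (u n - u n') p) ∂μ := by
      rw [← lintegral_const_mul' _ _ ENNReal.ofReal_ne_top, hPQ, h1]
      exact setLIntegral_mono' hQm hpt
    have h3 : ∫⁻ p in PQ, ENNReal.ofReal (g.gradSq (u n - u n') p) ∂μ ≤
        ENNReal.ofReal (c * ε.toReal ^ 2 / 2) := by
      have hgi : IntegrableOn (g.gradSq (u n - u n')) D μ :=
        ((continuous_innerDual_mvfderiv g (((hus n).sub (hus n')).of_le (by norm_cast))
          (((hus n).sub (hus n')).of_le (by norm_cast))).continuousOn.integrableOn_compact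
            hKD).mono_set hDKD
      calc ∫⁻ p in PQ, ENNReal.ofReal (g.gradSq (u n - u n') p) ∂μ
          ≤ ∫⁻ p in D, ENNReal.ofReal (g.gradSq (u n - u n') p) ∂μ := lintegral_mono_set hPQD
        _ = ENNReal.ofReal (∫ p in D, g.gradSq (u n - u n') p ∂μ) := by
            rw [ofReal_integral_eq_lintegral_ofReal hgi (Eventually.of_forall fun p ↦ ?_)]
            exact innerDual_self_nonneg' g hg p _
        _ ≤ ENNReal.ofReal (c * ε.toReal ^ 2 / 2) := ENNReal.ofReal_le_ofReal hEn.le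
    -- conclude `eLpNorm < ε`
    have hsq : eLpNorm (G n - G n') 2 ν ^ 2 = ∫⁻ w, ‖(G n - G n') w‖ₑ ^ 2 ∂ν :=
      eLpNorm_two_sq_eq _
    have h4 : eLpNorm (G n - G n') 2 ν ^ 2 ≤ ENNReal.ofReal (ε.toReal ^ 2 / 2) := by
      rw [hsq]
      have h5 := h2.trans h3
      have hc' : ENNReal.ofReal c ≠ 0 := (ENNReal.ofReal_pos.2 hc0).ne'
      calc ∫⁻ w, ‖(G n - G n') w‖ₑ ^ 2 ∂ν
          = (ENNReal.ofReal c)⁻¹ * (ENNReal.ofReal c * ∫⁻ w, ‖(G n - G n') w‖ₑ ^ 2 ∂ν) := by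
            rw [← mul_assoc, ENNReal.inv_mul_cancel hc' ENNReal.ofReal_ne_top, one_mul]
        _ ≤ (ENNReal.ofReal c)⁻¹ * ENNReal.ofReal (c * ε.toReal ^ 2 / 2) := by gcongr
        _ = ENNReal.ofReal (ε.toReal ^ 2 / 2) := by
            rw [← ENNReal.ofReal_inv_of_pos hc0, ← ENNReal.ofReal_mul (inv_nonneg.2 hc0.le)]
            congr 1
            field_simp
    by_contra hge'
    have hge := not_lt.1 hge'
    have h6 : ε ^ 2 ≤ eLpNorm (G n - G n') 2 ν ^ 2 := pow_le_pow_left₀ (by simp) hge 2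
    have h7 : ε ^ 2 = ENNReal.ofReal (ε.toReal ^ 2) := by
      rw [ENNReal.ofReal_pow hεr.le, ENNReal.ofReal_toReal hεt]
    rw [h7] at h6
    have h8 := (ENNReal.ofReal_le_ofReal_iff (by positivity)).1 (h6.trans h4)
    nlinarith
  obtain ⟨gu, hgum, hguconv⟩ := exists_memLp_tendsto_of_cauchy (ν := ν) one_le_two hGm hGcauchy
  have hguconv' : Tendsto (fun n ↦ eLpNorm (gu - G n) 2 ν) atTop (𝓝 0) :=
    hguconv.congr fun n ↦ eLpNorm_sub_comm _ _ _ _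
  have hconvU' : Tendsto (fun n ↦ eLpNorm (ut - ut_ n) 2 ν) atTop (𝓝 0) := by
    refine hconvU.congr fun n ↦ ?_
    have e : (fun w ↦ ut_ n w - ut w) = ut_ n - ut := rfl
    rw [e, eLpNorm_sub_comm]
  /- Step 5: `gu` is the weak gradient of `ut` on `Q` -/
  have hGinner : ∀ n, ∀ w ∈ Ψ.target, ∀ vv : EuclideanSpace ℝ (Fin m),
      ⟪G n w, vv⟫ = fderiv ℝ (ut_ n) w vv := fun n w _ vv ↦ by
    rw [hG, hut_eq, gradient, InnerProductSpace.toDual_symm_apply]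
  -- bounded continuous functions are in `L²(Q)`
  have hmem_cont : ∀ {k : EuclideanSpace ℝ (Fin m) → ℝ}, Continuous k → HasCompactSupport k →
      MemLp k 2 ν := fun hk _ ↦ hmemQ hk.continuousOn
  have hW : HasWeakFDerivOn ⟨Q, hQo⟩ volume ut (fun y ↦ innerSL ℝ (gu y)) := by
    refine ⟨?_, ?_, fun φt vv hφt ↦ ?_⟩
    · have hi : IntegrableOn ut Q volume := hutL.integrable one_le_two
      exact hi.locallyIntegrableOn
    · have hi : Integrable gu ν := hgum.integrable one_le_two
      have hi' : IntegrableOn (fun y ↦ innerSL ℝ (gu y)) Q volume :=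
        hi.norm.mono' ((innerSL ℝ).continuous.comp_aestronglyMeasurable hgum.1)
          (Eventually.of_forall fun y ↦ by rw [innerSL_apply_norm])
      exact hi'.locallyIntegrableOn
    · -- the identity for the smooth `ũₙ`, then pass to the limit
      have hWn : ∀ n, HasWeakFDerivOn ⟨Q, hQo⟩ volume (ut_ n) (fderiv ℝ (ut_ n)) := fun n ↦ by
        have hc : ContDiffOn ℝ ∞ (ut_ n) ((⟨Q, hQo⟩ : Opens (EuclideanSpace ℝ (Fin m))) : Set _) := by
          rw [hut_eq]; exact (hrep n).mono hQt
        exact MeyersSerrin.hasWeakFDerivOn_of_contDiffOn (μ := volume) hc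
      have hidn : ∀ n, ∫ w in Q, (fderiv ℝ φt w vv) • ut_ n w =
          -∫ w in Q, φt w * ⟪G n w, vv⟫ := fun n ↦ by
        have h0 := (hWn n).integral_fderiv_smul_eq φt vv hφt
        simp only [TopologicalSpace.Opens.coe_mk] at h0
        rw [h0]
        congr 1
        refine setIntegral_congr_fun hQm fun w hw ↦ ?_
        rw [smul_eq_mul, hGinner n w (hQt hw)]
      -- test data in `L²`
      have hφtc : Continuous φt := hφt.contDiff.continuous
      have hdφt : Continuous fun w ↦ fderiv ℝ φt w vv :=
        (hφt.contDiff.continuous_fderiv (by simp)).clm_apply continuous_const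
      have hm1 : MemLp (fun w ↦ fderiv ℝ φt w vv) 2 ν := hmem_cont hdφt
        (hφt.hasCompactSupport.fderiv_apply (𝕜 := ℝ) vv)
      have hm2 : MemLp φt 2 ν := hmem_cont hφtc hφt.hasCompactSupport
      -- left-hand sides converge
      have hL : Tendsto (fun n ↦ ∫ w in Q, (fderiv ℝ φt w vv) • ut_ n w) atTop
          (𝓝 (∫ w in Q, (fderiv ℝ φt w vv) • ut w)) := by
        have := tendsto_integral_bilin_of_tendsto_eLpNorm (μ := ν)
          ((ContinuousLinearMap.mul ℝ ℝ).flip) hut_m hutL hm1 hconvU'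
        simpa only [ContinuousLinearMap.flip_apply, ContinuousLinearMap.mul_apply', smul_eq_mul,
          mul_comm] using this
      -- right-hand sides converge
      have hB : ∀ (a : EuclideanSpace ℝ (Fin m)) (b : ℝ),
          ((ContinuousLinearMap.mul ℝ ℝ).flip.comp (innerSL ℝ vv)) a b = b * ⟪a, vv⟫ := fun a b ↦ by
        simp only [ContinuousLinearMap.comp_apply, ContinuousLinearMap.flip_apply,
          ContinuousLinearMap.mul_apply', innerSL_apply_apply, real_inner_comm vv]
      have hR0 := tendsto_integral_bilin_of_tendsto_eLpNorm (μ := ν)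
        (((ContinuousLinearMap.mul ℝ ℝ).flip).comp (innerSL ℝ vv)) hGm hgum hm2 hguconv'
      simp only [hB] at hR0
      have hR := hR0.neg
      have hlim := tendsto_nhds_unique (hL.congr fun n ↦ hidn n) hR
      show ∫ w in Q, (fderiv ℝ φt w vv) • ut w = -∫ w in Q, φt w • (innerSL ℝ (gu w)) vv
      rw [hlim]
      rfl
  /- Step 6: `ut ∘ Φ = v` a.e. on the piece over `Q` -/
  have hae : ∀ᵐ p ∂μ, p ∈ PQ → ut (Ψ (φ p)) = v p := by
    have h1 : ∀ᵐ p ∂μ, p ∈ D → v p = v' p := (ae_restrict_iff' hDm).1 hvv'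
    filter_upwards [h1] with p hp hpQ
    obtain ⟨hps, w, hwQ, hw⟩ := hpQ
    have hwt : w ∈ Ψ.target := hQt hwQ
    have hφp : Ψ (φ p) = w := by rw [← hw, Ψ.right_inv hwt]
    rw [hφp, hutQ w hwQ, hΦi, hw, φ.left_inv hps]
    exact (hp (hPQD ⟨hps, w, hwQ, hw⟩)).symm
  /- Step 7: the weak identity -/
  have hconvU2 : Tendsto (fun n ↦ eLpNorm (fun w ↦ u n (φ.symm (Ψ.symm w)) - ut w) 2 ν) atTop
      (𝓝 0) := by
    refine hconvU.congr fun n ↦ ?_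
    have e : (fun w ↦ ut_ n w - ut w) = fun w ↦ u n (φ.symm (Ψ.symm w)) - ut w :=
      funext fun w ↦ by rw [hut_, hΦi]
    rw [e]
  have hguconv2 : Tendsto (fun n ↦ eLpNorm (fun w ↦ gradient (u n ∘ φ.symm ∘ Ψ.symm) w - gu w) 2 ν)
      atTop (𝓝 0) := by
    refine hguconv.congr fun n ↦ ?_
    have e : G n - gu = fun w ↦ gradient (u n ∘ φ.symm ∘ Ψ.symm) w - gu w :=
      funext fun w ↦ by rw [Pi.sub_apply, hG]
    rw [e]
  refine ⟨ut, gu, hutL, hgum, hW, hae, hconvU2, hguconv2, fun ζ hζ hζc hζt ↦ ?_⟩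
  -- the pulled-back test function
  obtain ⟨hζPs, hζPc, hζval, -, -⟩ := compositePullback_props x hΨt hΨ hζ hζc (hζt.trans hBt)
  set ζP := (chartAt (EuclideanSpace ℝ (Fin m)) x).source.indicator
    (Ψ.source.indicator (ζ ∘ Ψ) ∘ extChartAt (𝓡 m) x) with hζP
  -- the Dirichlet pairings in the chart
  have hI : ∀ n, ∫ p in D, f p * g.innerDual p (mvfderiv (𝓡 m) (u n) p).toLinearMap
      (mvfderiv (𝓡 m) ζP p).toLinearMap ∂μ =
      ∫ w in Q, ρ w * (f (Φi w) * ⟪Mf w (G n w), gradient ζ w⟫) := by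
    intro n
    have h1 := setIntegral_mul_innerDual_compositePullback h x hΨt hΨ hΨ' hζ hζc hζt hBt hQm hQB
      hDm hDQ hf ((hus n).of_le (by norm_cast))
    refine h1.trans (setIntegral_congr_fun hQm fun w _ ↦ ?_)
    rw [hρ, hΦi, hMf, hG]
  -- the source pairing in the chart
  have hS : ∫ p in D, F p * ζP p ∂μ = ∫ w in Q, ρ w * (F (Φi w) * ζ w) := by
    have h1 := setIntegral_mul_compositePullback h x hΨt hΨ hΨ' hζ hζc hζt hBt hQm hQB hDm hDQ
      hF.measurable
    refine h1.trans (setIntegral_congr_fun hQm fun w _ ↦ ?_)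
    rw [hρ, hΦi]
  -- the limit of the Dirichlet pairings from the weak equation on `M`
  have hlim1 : Tendsto (fun n ↦ ∫ w in Q, ρ w * (f (Φi w) * ⟪Mf w (G n w), gradient ζ w⟫)) atTop
      (𝓝 (-∫ w in Q, ρ w * (F (Φi w) * ζ w))) := by
    have := hweak ζP hζPs
    rw [hS] at this
    exact this.congr fun n ↦ hI n
  -- the same limit computed in `L²(Q)`
  obtain ⟨T, hT⟩ : ∃ T : EuclideanSpace ℝ (Fin m) → EuclideanSpace ℝ (Fin m), ∀ w,
      T w = (ρ w * f (Φi w)) • Mf w (gradient ζ w) := ⟨_, fun _ ↦ rfl⟩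
  have hTc : ContinuousOn T Ψ.target := by
    have hgc : Continuous (gradient ζ) := by
      have := (hζ.continuous_fderiv (by simp))
      exact (InnerProductSpace.toDual ℝ _).symm.continuous.comp this
    have h1 : ContinuousOn (fun w ↦ Mf w (gradient ζ w)) Ψ.target :=
      hMc.clm_apply hgc.continuousOn
    have h2 : ContinuousOn (fun w ↦ ρ w * f (Φi w)) Ψ.target :=
      hρc.mul (hf.comp_continuousOn hΦic)
    exact (h2.smul h1).congr fun w _ ↦ hT w
  have hTm : MemLp T 2 ν := hmemQ' hTc
  have hinnerT : ∀ n w, ρ w * (f (Φi w) * ⟪Mf w (G n w), gradient ζ w⟫) = ⟪G n w, T w⟫ := by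
    intro n w
    rw [hT, real_inner_smul_right, hMf, compositeCoeff_inner_symm h x Ψ w]
    ring
  have hlim2 : Tendsto (fun n ↦ ∫ w in Q, ρ w * (f (Φi w) * ⟪Mf w (G n w), gradient ζ w⟫)) atTop
      (𝓝 (∫ w in Q, ⟪gu w, T w⟫)) := by
    have h0 := tendsto_integral_bilin_of_tendsto_eLpNorm (μ := ν) (innerSL ℝ) hGm hgum hTm hguconv'
    refine (h0.congr fun n ↦ ?_).congr' (Eventually.of_forall fun n ↦ rfl)
    refine setIntegral_congr_fun hQm fun w _ ↦ ?_
    rw [innerSL_apply_apply]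
    exact (hinnerT n w).symm
  have heq := tendsto_nhds_unique hlim2 hlim1
  -- rewrite both sides in the stated form
  have hL : ∫ w in Q, fderiv ℝ ζ w (((|(fderiv ℝ Ψ.symm w).det| *
      Real.sqrt (chartGramMatrix h x (Ψ.symm w)).det) * f (φ.symm (Ψ.symm w))) •
        (∑ i, ∑ j, (chartGramMatrix h x (Ψ.symm w))⁻¹ i j •
          (innerSL ℝ (fderiv ℝ Ψ (Ψ.symm w) (EuclideanSpace.single i 1))).smulRight
            (fderiv ℝ Ψ (Ψ.symm w) (EuclideanSpace.single j 1))) (gu w)) =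
      ∫ w in Q, ⟪gu w, T w⟫ := by
    refine setIntegral_congr_fun hQm fun w _ ↦ ?_
    rw [← hρ, ← hMf, ← hΦi, hT]
    have e1 : fderiv ℝ ζ w ((ρ w * f (Φi w)) • Mf w (gu w)) =
        ⟪gradient ζ w, (ρ w * f (Φi w)) • Mf w (gu w)⟫ := by
      rw [gradient, InnerProductSpace.toDual_symm_apply]
    have e2 : ⟪gradient ζ w, Mf w (gu w)⟫ = ⟪gu w, Mf w (gradient ζ w)⟫ := by
      rw [real_inner_comm (Mf w (gu w)) (gradient ζ w), hMf, compositeCoeff_inner_symm h x Ψ w]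
    rw [e1, real_inner_smul_right, real_inner_smul_right, e2]
  have hRt : ∫ w in Q, -((|(fderiv ℝ Ψ.symm w).det| *
      Real.sqrt (chartGramMatrix h x (Ψ.symm w)).det) * F (φ.symm (Ψ.symm w))) * ζ w =
      -∫ w in Q, ρ w * (F (Φi w) * ζ w) := by
    rw [← integral_neg]
    refine setIntegral_congr_fun hQm fun w _ ↦ ?_
    rw [← hρ, ← hΦi]; ring
  rw [hL, hRt]
  exact heq

end Literature.Geometry.Riemannian

end
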